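import Mathlib
import HarnessLib
import Summits.HubbardSuperconductivity.HubbardSuperconductivity.Theorems.KLProgrammeKLRegimeEngineNearSupFromValue
import Summits.HubbardSuperconductivity.HubbardSuperconductivity.Theorems.KLProgrammeH10TwoPointLimitFrameTorusBridge
import Summits.HubbardSuperconductivity.HubbardSuperconductivity.Theorems.KLProgrammeH10TwoPointLimitIsoSymbolDiffs

/-!
# Route `KLProgramme` — ENGINE item stmt-HubbardSuperconductivity-20437, class #6 / (E5-F)ₙ producer, route (M) of the (α-0) memo:
# the near/far inequality for the class-#6 size `fixedTupleL1 β 3 (klIsoKernelAt … K n m) Ω x₁` ON AN ISO BOX, from the quartic VALUE on the box,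
# the pinned FIRST MOMENTS, the NEAR COUNT and the SUPPORT COUNTS — the M3 assembly shape with M1 (counts) and M2 (moments) left as inputs

Cell gate-hubbard-kl, seat hubbard-kl-k3c2-p2 (g11; owner-designate of M1 + M3 of route (M), pen (R59az)).  Instantiates `…EngineNearSupFromValue` on the iso family
`F̄_m = klIsoFamily … K klE0 m` of the class-#6 object `klIsoKernelAt … K n m = sectorisedKernel β F̄_m 𝒱ₙ[K] 4`: on the support box of a BGM-ordered iso tuple `Ω`
(charges `(+,−,+,−)`, spins `(σ,σ,σ′,σ′)`) every leg has `|ω| < Λ_m` (`support_klIsoFamily`), so against the (E5-F) reference pattern `(ω₀,ω₀,−ω₀,−ω₀)`, `ω₀ = π/β`,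
the free legs' dual distances are `≤ Λ_m + π/β` with the SAME spatial momenta:

* §1 `abs_matsubaraFreq_sub_omega0_le_of_klIsoFamily_ne_zero` (`|ω_k ∓ ω₀| ≤ Λ_m + π/β` on the box);
  **`pow_mul_norm_prodKernel_klIso_le_quarticValue_add_moments`**: for a conserving string `k` in the box,
  `(βL²)³·|T(k)| ≤ ‖klQuarticValue … K n σ σ′ k⃗₀ k⃗₁ k⃗₂‖/24 + (Λ_m + π/β)·Σ_{j<3} Mom_j(Ω, x₁)`, `Mom_j(Ω,x₁) = ε³ Σ_y spaceTimeDist x₁ (y_j)·‖klIsoKernelAt … n m Ω (x₁::y)‖`;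
* §2 **`supT_klIso_le_of_value_moments`**: a value bound `B` on the box (`‖klQuarticValue … (k 0).2 (k 1).2 (k 2).2‖ ≤ B` for conserving box strings) and a moment bound `Mom`
  give the `T`-sup `S = (B/24 + (Λ_m + π/β)·3·Mom)/(βL²)³` on the whole box (off the conservation surface `T = 0`);
* §3 **`fixedTupleL1_klIsoKernelAt_le_of_value_moments_counts`** — THE M3 SHAPE: with the near count `#{y : spaceTimeDist x₁ y < R} ≤ N_R` and the free legs' support counts,
  `fixedTupleL1 β 3 (klIsoKernelAt … K n m) Ω x₁ ≤ ε³·N_R³·(∏_{j<3} #supp F̄_{m,ω_{j+1}})·(B/24 + (Λ_m + π/β)·3·Mom)/(βL²)³ + 3·Mom/R`.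

What remains for route (M) after this file (T+ work, by name): M1 = the calibration `ε³·N_R³·∏#supp/(βL²)³ = O(ρ⁹)` for `R = ρ/Λ_m` (`card_spaceTimeBall_le_real` × iso support
counts); M2 = the per-tuple moments `Mom` ((E4-iso)ₙ); the value bound `B` from (E5-F)ₙ's hypothesis on `klBall L μ 0` (ball inclusion for box momenta, `mem_klBall_of_klIsoFamily_ne_zero`
gives `klBall L μ K`); spin patterns `σ = σ′` (M4 (i)); then `IsoTupleLineAt`/`isoTupleL1AtV17F_of_fixedTuple_le` (this lineage's door).  Everything is proved; no definitions;
nothing about the model is asserted beyond these implications.  References: BGM 2006 §2.4 (2.52), §2.7 (2.69)–(2.71a) [cite: BenfattoGiulianiMastropietro2006].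
-/

noncomputable section

namespace Summit.HubbardSuperconductivity.HubbardSuperconductivity.Theorems.EngineV8

set_option linter.dupNamespace false -- summit = problem name (single-conjunct summit), D-0017

open Classical
open Real Finset Complex Literature.MathematicalPhysics.QuantumLattice Literature.Probability.LatticeModels GrassmannAlgebra
open Summit.HubbardSuperconductivity.HubbardSuperconductivity.Theorems.KLProgrammeLegKernels
open Summit.HubbardSuperconductivity.HubbardSuperconductivity.Theorems.KLRegimeSplit
open scoped ComplexConjugate

open Summit.HubbardSuperconductivity.HubbardSuperconductivity.Theorems.KLRegimeWick
open Summit.HubbardSuperconductivity.HubbardSuperconductivity.Theorems.PerturbedFermiCurve (support_klIsoFamily)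
open Summit.HubbardSuperconductivity.HubbardSuperconductivity.Theorems.TorusFourierL2 (norm_klIsoFamily_le_one)

variable {L M : ℕ} [NeZero L] [NeZero M]

/-! ## §1 The box instance of the `T`-sup from the value -/

section Box

omit [NeZero L] in
/-- On the support box of an iso multiplier at resolution `m` every frequency is within `Λ_m + π/β` of `±ω₀` (`0 < β`). -/
theorem abs_matsubaraFreq_sub_omega0_le_of_klIsoFamily_ne_zero {β : ℝ} (hβ : 0 < β) (μ : ℝ) (K : TrigPolyC4v) (m : ℕ)
    (ω : Fin (sectorCount (2 * m))) (k : FreqMomentum L M) (h : klIsoFamily L M β μ K klE0 m ω k ≠ 0) :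
    |matsubaraFreq β M k.1 - matsubaraFreq β M (omega0 M)| ≤ klScale klE0 m + π / β ∧
      |matsubaraFreq β M k.1 - matsubaraFreq β M (omega0 M).rev| ≤ klScale klE0 m + π / β := by
  have he : (0 : ℝ) < klE0 := by norm_num [klE0]
  have hω := (support_klIsoFamily L M he β μ K m ω k h).2.1
  have hπβ : 0 ≤ π / β := div_nonneg Real.pi_pos.le hβ.le
  rw [matsubaraFreq_omega0, matsubaraFreq_omega0_rev]
  constructor
  · calc |matsubaraFreq β M k.1 - π / β| ≤ |matsubaraFreq β M k.1| + |π / β| := abs_sub _ _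
      _ ≤ klScale klE0 m + π / β := add_le_add hω.le (le_of_eq (abs_of_nonneg hπβ))
  · calc |matsubaraFreq β M k.1 - -(π / β)| ≤ |matsubaraFreq β M k.1| + |-(π / β)| := abs_sub _ _
      _ ≤ klScale klE0 m + π / β := add_le_add hω.le (le_of_eq (by rw [abs_neg, abs_of_nonneg hπβ]))

/-- **THE `T`-SUP ON AN ISO BOX FROM THE VALUE** (`0 < β`; `Ω` a BGM-ordered iso tuple at resolution `m`: charges `(+,−,+,−)`, spins `(σ,σ,σ′,σ′)`; `k` a conserving string in
the support box; any pin `x₁`): `(βL²)³·‖(∏_i F̄_{m,ω_i}(k_i))·K_n(k)‖ ≤ ‖klQuarticValue … K n σ σ′ k⃗₀ k⃗₁ k⃗₂‖/24 + (Λ_m + π/β)·Σ_{j<3} ε³ Σ_y spaceTimeDist x₁ (y_j)·‖klIsoKernelAt … n m Ω (x₁::y)‖`. -/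
theorem pow_mul_norm_prodKernel_klIso_le_quarticValue_add_moments {β : ℝ} (hβ : 0 < β) (U μ : ℝ) (K : TrigPolyC4v) (n m : ℕ)
    (Ω : Fin 4 → SectorLeg (sectorCount (2 * m))) (h0 : (Ω 0).2 = 0) (h1 : (Ω 1).2 = 1) (h2 : (Ω 2).2 = 0) (h3 : (Ω 3).2 = 1)
    {σ σ' : Fin 2} (hs0 : (Ω 0).1.2 = σ) (hs1 : (Ω 1).1.2 = σ) (hs2 : (Ω 2).1.2 = σ') (hs3 : (Ω 3).1.2 = σ')
    (k : Fin 4 → FreqMomentum L M)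
    (hf : ∑ i, (if (Ω i).2 = 0 then (1 : ℤ) else -1) * matsubaraInt M (k i).1 = 0) (hm : ∑ i, signedMomentum L (Ω i).2 (k i).2 = 0)
    (hsupp : ∀ i, klIsoFamily L M β μ K klE0 m (Ω i).1.1 (k i) ≠ 0) (x₁ : SpaceTimeIdx L M) :
    (β * (L : ℝ) ^ 2) ^ 3 *
        ‖(∏ i, klIsoFamily L M β μ K klE0 m (Ω i).1.1 (k i)) *
          kernel ℂ (klEffectiveAction L M β U μ K klE0 n) 4 (fun i => ((k i, (Ω i).1.2), (Ω i).2))‖ ≤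
      ‖klQuarticValue L M β U μ K n σ σ' (k 0).2 (k 1).2 (k 2).2‖ / 24 +
        (klScale klE0 m + π / β) * ∑ j : Fin 3, imagTimeWeight β M ^ 3 * ∑ y : Fin 3 → SpaceTimeIdx L M,
          spaceTimeDist L M β x₁ (y j) * ‖klIsoKernelAt L M β U μ K n m Ω (Matrix.vecCons x₁ y)‖ :=
  pow_mul_norm_prodKernel_klEffectiveAction_le_quarticValue_add_moments hβ (klIsoFamily L M β μ K klE0 m)
    (fun ω q => norm_klIsoFamily_le_one β μ K klE0 m ω q) U μ K n Ω h0 h1 h2 h3 hs0 hs1 hs2 hs3 k hf hm x₁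
    (abs_matsubaraFreq_sub_omega0_le_of_klIsoFamily_ne_zero hβ μ K m _ _ (hsupp 1)).1
    (abs_matsubaraFreq_sub_omega0_le_of_klIsoFamily_ne_zero hβ μ K m _ _ (hsupp 2)).2
    (abs_matsubaraFreq_sub_omega0_le_of_klIsoFamily_ne_zero hβ μ K m _ _ (hsupp 3)).2

end Box

/-! ## §2 The `T`-sup on the whole box from a value bound and a moment bound -/

section Sup

/-- **`T`-SUP ON THE BOX**: if `‖klQuarticValue … n σ σ′ k⃗₀ k⃗₁ k⃗₂‖ ≤ B` for every conserving string of the box and the three pinned first moments of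
`klIsoKernelAt … n m Ω` at `x₁` are `≤ Mom`, then `‖(∏F̄)·K(k)‖ ≤ (B/24 + (Λ_m + π/β)·3·Mom)/(βL²)³` for EVERY string `k` of the box (conserving or not). -/
theorem supT_klIso_le_of_value_moments {β : ℝ} (hβ : 0 < β) (U μ : ℝ) (K : TrigPolyC4v) (n m : ℕ)
    (Ω : Fin 4 → SectorLeg (sectorCount (2 * m))) (h0 : (Ω 0).2 = 0) (h1 : (Ω 1).2 = 1) (h2 : (Ω 2).2 = 0) (h3 : (Ω 3).2 = 1)
    {σ σ' : Fin 2} (hs0 : (Ω 0).1.2 = σ) (hs1 : (Ω 1).1.2 = σ) (hs2 : (Ω 2).1.2 = σ') (hs3 : (Ω 3).1.2 = σ')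
    (x₁ : SpaceTimeIdx L M) {B Mom : ℝ} (hB0 : 0 ≤ B)
    (hB : ∀ k : Fin 4 → FreqMomentum L M, (∀ i, klIsoFamily L M β μ K klE0 m (Ω i).1.1 (k i) ≠ 0) →
      (∑ i, (if (Ω i).2 = 0 then (1 : ℤ) else -1) * matsubaraInt M (k i).1) = 0 → (∑ i, signedMomentum L (Ω i).2 (k i).2) = 0 →
        ‖klQuarticValue L M β U μ K n σ σ' (k 0).2 (k 1).2 (k 2).2‖ ≤ B)
    (hMom : ∀ j : Fin 3, imagTimeWeight β M ^ 3 * ∑ y : Fin 3 → SpaceTimeIdx L M,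
      spaceTimeDist L M β x₁ (y j) * ‖klIsoKernelAt L M β U μ K n m Ω (Matrix.vecCons x₁ y)‖ ≤ Mom) :
    ∀ k : Fin 4 → FreqMomentum L M, (∀ i, klIsoFamily L M β μ K klE0 m (Ω i).1.1 (k i) ≠ 0) →
      ‖(∏ i, klIsoFamily L M β μ K klE0 m (Ω i).1.1 (k i)) *
          kernel ℂ (klEffectiveAction L M β U μ K klE0 n) 4 (fun i => ((k i, (Ω i).1.2), (Ω i).2))‖ ≤
        (B / 24 + (klScale klE0 m + π / β) * (3 * Mom)) / (β * (L : ℝ) ^ 2) ^ 3 := by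
  intro k hsupp
  have hL0 : (0 : ℝ) < L := Nat.cast_pos.2 (Nat.pos_of_ne_zero (NeZero.ne L))
  have hβL : 0 < (β * (L : ℝ) ^ 2) ^ 3 := pow_pos (mul_pos hβ (pow_pos hL0 2)) 3
  have hMom0 : 0 ≤ Mom := le_trans (mul_nonneg (pow_nonneg (imagTimeWeight_nonneg hβ.le M) 3) (sum_nonneg fun y _ =>
    mul_nonneg (by unfold KLRegimeSplit.spaceTimeDist; exact le_max_of_le_right (le_max_of_le_left (Nat.cast_nonneg _))) (norm_nonneg _))) (hMom 0)
  have hΛ : 0 ≤ klScale klE0 m + π / β := add_nonneg (by unfold klScale klE0; positivity) (div_nonneg Real.pi_pos.le hβ.le)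
  rw [le_div_iff₀ hβL, mul_comm]
  by_cases hcons : (∑ i, (if (Ω i).2 = 0 then (1 : ℤ) else -1) * matsubaraInt M (k i).1) = 0 ∧ (∑ i, signedMomentum L (Ω i).2 (k i).2) = 0
  · refine (pow_mul_norm_prodKernel_klIso_le_quarticValue_add_moments hβ U μ K n m Ω h0 h1 h2 h3 hs0 hs1 hs2 hs3 k hcons.1 hcons.2 hsupp x₁).trans ?_
    refine add_le_add (div_le_div_of_nonneg_right (hB k hsupp hcons.1 hcons.2) (by norm_num)) (mul_le_mul_of_nonneg_left ?_ hΛ)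
    calc ∑ j : Fin 3, imagTimeWeight β M ^ 3 * ∑ y : Fin 3 → SpaceTimeIdx L M,
          spaceTimeDist L M β x₁ (y j) * ‖klIsoKernelAt L M β U μ K n m Ω (Matrix.vecCons x₁ y)‖
        ≤ ∑ _j : Fin 3, Mom := sum_le_sum fun j _ => hMom j
      _ = 3 * Mom := by rw [sum_const, card_univ, Fintype.card_fin, nsmul_eq_mul]; norm_num
  · -- off the conservation surface the kernel vanishes
    have hK : kernel ℂ (klEffectiveAction L M β U μ K klE0 n) 4 (fun i => ((k i, (Ω i).1.2), (Ω i).2)) = 0 := by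
      rcases not_and_or.1 hcons with h | h
      · exact kernel_klEffectiveAction_eq_zero_of_freq β U μ K klE0 n (by simpa using h)
      · exact klEffectiveAction_momentumConserving β U μ K klE0 n 4 _ (by simpa using h)
    rw [hK, mul_zero, norm_zero, mul_zero]
    exact add_nonneg (div_nonneg hB0 (by norm_num)) (mul_nonneg hΛ (by linarith))

end Sup

/-! ## §3 The M3 shape: near/far for the class-#6 size on an iso box -/

section Assembly

/-- **NEAR/FAR FOR THE CLASS-#6 SIZE ON AN ISO BOX** (`0 < β`; `Ω` BGM-ordered iso tuple at resolution `m`, spins `(σ,σ,σ′,σ′)`; pin `x₁`; radius `R > 0`).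
Inputs: the value bound `B` on the box's conserving strings, the moment bound `Mom` on the three pinned first moments, the near count `N_R`.  Output:
`fixedTupleL1 β 3 (klIsoKernelAt … K n m) Ω x₁ ≤ ε³·N_R³·(∏_{j<3} #supp F̄_{m,ω_{j+1}})·(B/24 + (Λ_m + π/β)·3·Mom)/(βL²)³ + 3·Mom/R`. -/
theorem fixedTupleL1_klIsoKernelAt_le_of_value_moments_counts {β : ℝ} (hβ : 0 < β) (U μ : ℝ) (K : TrigPolyC4v) (n m : ℕ)
    (Ω : Fin 4 → SectorLeg (sectorCount (2 * m))) (h0 : (Ω 0).2 = 0) (h1 : (Ω 1).2 = 1) (h2 : (Ω 2).2 = 0) (h3 : (Ω 3).2 = 1)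
    {σ σ' : Fin 2} (hs0 : (Ω 0).1.2 = σ) (hs1 : (Ω 1).1.2 = σ) (hs2 : (Ω 2).1.2 = σ') (hs3 : (Ω 3).1.2 = σ')
    (x₁ : SpaceTimeIdx L M) {B Mom NR R : ℝ} (hR : 0 < R) (hB0 : 0 ≤ B)
    (hB : ∀ k : Fin 4 → FreqMomentum L M, (∀ i, klIsoFamily L M β μ K klE0 m (Ω i).1.1 (k i) ≠ 0) →
      (∑ i, (if (Ω i).2 = 0 then (1 : ℤ) else -1) * matsubaraInt M (k i).1) = 0 → (∑ i, signedMomentum L (Ω i).2 (k i).2) = 0 →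
        ‖klQuarticValue L M β U μ K n σ σ' (k 0).2 (k 1).2 (k 2).2‖ ≤ B)
    (hMom : ∀ j : Fin 3, imagTimeWeight β M ^ 3 * ∑ y : Fin 3 → SpaceTimeIdx L M,
      spaceTimeDist L M β x₁ (y j) * ‖klIsoKernelAt L M β U μ K n m Ω (Matrix.vecCons x₁ y)‖ ≤ Mom)
    (hN : ((((univ : Finset (SpaceTimeIdx L M)).filter fun y => spaceTimeDist L M β x₁ y < R).card : ℕ) : ℝ) ≤ NR) :
    fixedTupleL1 L M β 3 (klIsoKernelAt L M β U μ K n m) Ω x₁ ≤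
      imagTimeWeight β M ^ 3 * NR ^ 3 *
          ((∏ j : Fin 3, (((univ : Finset (FreqMomentum L M)).filter fun q => klIsoFamily L M β μ K klE0 m (Ω j.succ).1.1 q ≠ 0).card : ℝ)) *
            ((B / 24 + (klScale klE0 m + π / β) * (3 * Mom)) / (β * (L : ℝ) ^ 2) ^ 3)) +
        3 * Mom / R := by
  have hL0 : (0 : ℝ) < L := Nat.cast_pos.2 (Nat.pos_of_ne_zero (NeZero.ne L))
  have hβL : 0 < (β * (L : ℝ) ^ 2) ^ 3 := pow_pos (mul_pos hβ (pow_pos hL0 2)) 3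
  have hMom0 : 0 ≤ Mom := le_trans (mul_nonneg (pow_nonneg (imagTimeWeight_nonneg hβ.le M) 3) (sum_nonneg fun y _ =>
    mul_nonneg (by unfold KLRegimeSplit.spaceTimeDist; exact le_max_of_le_right (le_max_of_le_left (Nat.cast_nonneg _))) (norm_nonneg _))) (hMom 0)
  have hΛ : 0 ≤ klScale klE0 m + π / β := add_nonneg (by unfold klScale klE0; positivity) (div_nonneg Real.pi_pos.le hβ.le)
  have hS0 : 0 ≤ (B / 24 + (klScale klE0 m + π / β) * (3 * Mom)) / (β * (L : ℝ) ^ 2) ^ 3 :=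
    div_nonneg (add_nonneg (div_nonneg hB0 (by norm_num)) (mul_nonneg hΛ (by linarith))) hβL.le
  have h := fixedTupleL1_le_near_supT_add_far (m := 3) hβ.le (klIsoFamily L M β μ K klE0 m) (klEffectiveAction L M β U μ K klE0 n)
    (fun _ _ hX => kernel_klEffectiveAction_eq_zero_of_freq β U μ K klE0 n hX)
    (fun m' X hX => klEffectiveAction_momentumConserving β U μ K klE0 n m' X hX) Ω x₁ hR hS0
    (supT_klIso_le_of_value_moments hβ U μ K n m Ω h0 h1 h2 h3 hs0 hs1 hs2 hs3 x₁ hB0 hB hMom) hMom hN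
  simpa [klIsoKernelAt] using h

end Assembly

/-! ## §4 (appended) Ball inclusion and the `(σ,σ′) = (0,1)` instance fed by an (E5-F)-type value hypothesis on `klBall L μ 0` -/

section Ball

omit [NeZero M] in
/-- **Box momenta lie in the bare ball** when the frame is small: if `|K(p_k⃗)| ≤ A` on the torus and `Λ_m + A ≤ klE0`, then
`F̄_{m,ω}(k) ≠ 0 ⇒ k⃗ ∈ klBall L μ 0` (`|ξ(k⃗)| ≤ |e_K(k⃗)| + |K(p_k⃗)| < Λ_m + A`). -/
theorem mem_klBall_zero_of_klIsoFamily_ne_zero (β μ : ℝ) (K : TrigPolyC4v) {A : ℝ} (hK : ∀ k : TorusSite 2 L, |K.eval (latticeMomentum L k)| ≤ A)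
    (m : ℕ) (hA : klScale klE0 m + A ≤ klE0) (ω : Fin (sectorCount (2 * m))) (k : FreqMomentum L M)
    (h : klIsoFamily L M β μ K klE0 m ω k ≠ 0) : k.2 ∈ klBall L μ 0 := by
  have he : (0 : ℝ) < klE0 := by norm_num [klE0]
  have hshell := (support_klIsoFamily L M he β μ K m ω k h).1
  rw [klBall, klShell, mem_momentumShell, klScale, pow_zero, inv_one, mul_one, nambuXiCT_zero_frame, nambuXi_eq_nambuXiCT_add L μ K]
  calc |nambuXiCT L μ K k.2 + K.eval (latticeMomentum L k.2)| ≤ |nambuXiCT L μ K k.2| + |K.eval (latticeMomentum L k.2)| := abs_add_le _ _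
    _ ≤ klScale klE0 m + A := add_le_add hshell.le (hK k.2)
    _ ≤ klE0 := hA

/-- **THE M3 SHAPE FED BY AN (E5-F)-TYPE VALUE HYPOTHESIS** (`(σ,σ′) = (0,1)`, the pattern of `IsoTupleL1AtV17F`): for a BGM-ordered iso tuple with spins `(0,0,1,1)`,
a small frame (`|K(p_k⃗)| ≤ A`, `Λ_m + A ≤ klE0`), a value bound `‖klQuarticValue … K n 0 1 k₁ k₂ k₃‖ ≤ B` on `klBall L μ 0`, a moment bound `Mom` and a near count `N_R`:
`fixedTupleL1 β 3 (klIsoKernelAt … K n m) Ω x₁ ≤ ε³·N_R³·(∏_{j<3} #supp F̄_{m,ω_{j+1}})·(B/24 + (Λ_m + π/β)·3·Mom)/(βL²)³ + 3·Mom/R`. -/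
theorem fixedTupleL1_klIsoKernelAt_le_of_ballValue_moments_counts {β : ℝ} (hβ : 0 < β) (U μ : ℝ) (K : TrigPolyC4v) {A : ℝ}
    (hK : ∀ k : TorusSite 2 L, |K.eval (latticeMomentum L k)| ≤ A) (n m : ℕ) (hA : klScale klE0 m + A ≤ klE0)
    (Ω : Fin 4 → SectorLeg (sectorCount (2 * m))) (h0 : (Ω 0).2 = 0) (h1 : (Ω 1).2 = 1) (h2 : (Ω 2).2 = 0) (h3 : (Ω 3).2 = 1)
    (hs0 : (Ω 0).1.2 = 0) (hs1 : (Ω 1).1.2 = 0) (hs2 : (Ω 2).1.2 = 1) (hs3 : (Ω 3).1.2 = 1)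
    (x₁ : SpaceTimeIdx L M) {B Mom NR R : ℝ} (hR : 0 < R) (hB0 : 0 ≤ B)
    (hB : ∀ k₁ ∈ klBall L μ 0, ∀ k₂ ∈ klBall L μ 0, ∀ k₃ ∈ klBall L μ 0, ‖klQuarticValue L M β U μ K n 0 1 k₁ k₂ k₃‖ ≤ B)
    (hMom : ∀ j : Fin 3, imagTimeWeight β M ^ 3 * ∑ y : Fin 3 → SpaceTimeIdx L M,
      spaceTimeDist L M β x₁ (y j) * ‖klIsoKernelAt L M β U μ K n m Ω (Matrix.vecCons x₁ y)‖ ≤ Mom)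
    (hN : ((((univ : Finset (SpaceTimeIdx L M)).filter fun y => spaceTimeDist L M β x₁ y < R).card : ℕ) : ℝ) ≤ NR) :
    fixedTupleL1 L M β 3 (klIsoKernelAt L M β U μ K n m) Ω x₁ ≤
      imagTimeWeight β M ^ 3 * NR ^ 3 *
          ((∏ j : Fin 3, (((univ : Finset (FreqMomentum L M)).filter fun q => klIsoFamily L M β μ K klE0 m (Ω j.succ).1.1 q ≠ 0).card : ℝ)) *
            ((B / 24 + (klScale klE0 m + π / β) * (3 * Mom)) / (β * (L : ℝ) ^ 2) ^ 3)) +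
        3 * Mom / R :=
  fixedTupleL1_klIsoKernelAt_le_of_value_moments_counts hβ U μ K n m Ω h0 h1 h2 h3 hs0 hs1 hs2 hs3 x₁ hR hB0
    (fun _ hsupp _ _ => hB _ (mem_klBall_zero_of_klIsoFamily_ne_zero β μ K hK m hA _ _ (hsupp 0))
      _ (mem_klBall_zero_of_klIsoFamily_ne_zero β μ K hK m hA _ _ (hsupp 1))
      _ (mem_klBall_zero_of_klIsoFamily_ne_zero β μ K hK m hA _ _ (hsupp 2))) hMom hN

end Ball

end Summit.HubbardSuperconductivity.HubbardSuperconductivity.Theorems.EngineV8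

end
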